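import Summits.BirchSwinnertonDyer.BirchSwinnertonDyer.Theorems.SignedLowerHalvesKobayashiMainConjectureSmallImageMuSaturation
import Summits.BirchSwinnertonDyer.Rank1Residual.Partition.MainConjecturesCMSupersingular
import Literature.NumberTheory.EllipticCurves.BDKim2009.SignedSelmerCongruentMuInvariant
import Literature.NumberTheory.EllipticCurves.SelmerTrivialCorankProofs
import Literature.NumberTheory.EllipticCurves.Rank1Residual.Typed.X7
import HarnessLib

/-!
# Route `SignedLowerHalves`, crux `KobayashiMainConjectureSmallImage` (item stmt-BirchSwinnertonDyer-19002):
# the `μ`-SATURATION, part 3 — `μ(X^ε(E)) = 0` TRANSFERS from a UNIT PARTNER (a congruent curve with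
# trivial `p`-Selmer group and `p ∤ ∏ c_ℓ`) by B. D. Kim 2013 Cor. 3.15 + B. D. Kim 2009 Cor. 2.13 —
# NO CM, NO `p`-adic `L`-function of the partner, NO preprint
# (cell `bsd-ssimc`, seat `bsd-ssimc-k3-c4` gen 5, object «L4-UP»; helper file, `--supports … --as helper`)

HONEST FRAMING: Kobayashi's signed main conjecture at a non-surjective (normaliser-of-non-split-Cartan)
image is OPEN; nothing here proves it for the class. This file proves CONDITIONAL theorems whose
non-published inputs are DISPLAYED binders: per curve a partner `A/ℚ` with good reduction at `p`,
`a_p(A) = 0`, a `Γ_ℚ`-equivariant `E[p] ≃ A[p]`, `#Sel^(p)(A/ℚ) = 1` (an EXACT descent line) and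
`p ∤ ∏_ℓ c_ℓ(A)` (Cremona's row), and — in rank `0` — `BSD(E,p)` (settled per pair in the tree by exact
descent); everything else is a PUBLISHED named fact consumed BY NAME: B. D. Kim 2009 Cor. 2.13
(`BDKim2009.cor213_signedMu_eq_zero_iff_of_torsionIso`), B. D. Kim 2013 Cor. 3.15
(`BDKim2013.cor315_signedCharValue_rankZero`), Kobayashi 2003 Thm. 1.2 / Thm. 4.1 (RATIONAL clause),
GZK, modularity, the period-unit facts. Compared with part 2 (`…SmallImageMuTransferCM.lean`, the CM
partner), Pollack–Rubin, Pollack's `L_p^±` of the partner, the modular parametrisation of the partner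
and any `μ`-certificate DISAPPEAR from the binder list. Item 4 stays OPEN; nothing is booked; BSD is not
proved by any of this.

PARTITION (cell bsd-ssimc): X7 (A7) × item 4's non-surjective `a_p = 0` pairs that admit a UNIT
partner (census of this seat: 5 of the 57 CM-partnerless window pairs, all at `p = 3`, partner
`8477b1`; the mechanism is image-free) — types-the-object-of; closes NONE.

## The observation (the supersingular twin of the cell's ordinary «route U2», `Rank1Residual/X9TrivialPartner.lean`)

In part 1's PRE-free rank-`0` chain `kobayashiMainConjecture_of_mu_eq_zero_of_bsdp_of_analyticRank_eq_zero`
the only input beyond `BSD(E,p)` and published facts is `μ(X^ε(E/ℚ_∞)) = 0`. B. D. Kim 2009 Cor. 2.13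
transfers `μ = 0` along ANY `Γ_ℚ`-isomorphism `E[p] ≅ A[p]` between curves of good reduction at `p`
with `a_p = 0` — printed hypotheses, read at the page (Asian J. Math. 13 (2009) p. 182 §2 l. 3–4: "Let
`E` be an elliptic curve over `ℚ` and fix an odd prime `p`. We assume `E` has good supersingular
reduction at `p` and `a_p = 1 + p − |Ẽ(𝔽_p)|` is `0`"; p. 186 l. 1–3: "Let `E'/ℚ` be an elliptic curve
with `E[p] ≅ E'[p]` as `G_ℚ`-modules. Assume `Σ` contains all the bad reduction primes of `E` and
`E'`"; NO irreducibility, surjectivity, semistability or CM hypothesis — the tree fact p446809 carries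
exactly these binders). And for a partner `A` in the ALGEBRAIC UNIT CASE — `#Sel^(p)(A/ℚ) = 1` and
`p ∤ ∏_ℓ c_ℓ(A)` — `μ(X^ε(A/ℚ_∞)) = 0` for EVERY sign is a consequence of B. D. Kim 2013 Cor. 3.15
ALONE (J. Aust. Math. Soc. 95, p. 199: "Assume that `Sel_p(E/F)` is finite … `|f^±(0)| ∼ |Sel_p(E/F)|
∏_v c_v`"): `#Sel^(p) = 1` forces `rank A(ℚ) = 0`, `Ш(A/ℚ)[p^∞] = 0`, `#Sel_{p^∞}(A/ℚ) = 1`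
(fact-free, `natCard_selmerGroupPInfty_eq_one_of_natCard_selmerGroup_eq_one`, Silverman X.4.2), so a
characteristic power series `ξ^ε` of `X^ε(A/ℚ_∞)` has `ξ^ε(0) ∈ ℤ_p^×`, i.e. unit content (indeed
`X^ε(A/ℚ_∞)` is finite). No main conjecture, no `p`-adic `L`-function, no analytic rank of the partner.

* §1 `signedMu_eq_zero_of_selmerTrivial` — the partner side (any curve `V`): Kim 2013 ⟹ `μ(X^ε(V)) = 0`.
* §2 `mu_eq_zero_of_unitPartner` — + Kim 2009 along `E[p] ≃ A[p]` ⟹ `μ(X^ε(E/ℚ_∞)) = 0`, every sign,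
  every dual datum.
* §3 the class theorems: `kobayashiMainConjecture_of_unitPartner_of_bsdp_of_analyticRank_eq_zero`
  (rank `0`, + `BSD(E,p)`, both signs), `kobayashiMainConjecture_iff_bsdp_of_unitPartner_of_analyticRank_eq_zero`
  (on that locus, either sign ⟺ `BSD(E,p)`), `kobayashiMainConjecture_of_selmerTrivial_of_bsdp_of_analyticRank_eq_zero`
  (the degenerate partner `A = E`: the unit zone, cf. `smallImage_kobayashiMainConjecture_of_units_of_bsdp_…`
  of `…SmallImageSaturationRankZero.lean`), `kobayashiMainConjecture_of_unitPartner_of_lowerDivisibility`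
  (saturation, ANY rank) and `stub_saturationSmallImage_of_unitPartner` — the registered stub
  `stub_saturationSmallImage` header VERBATIM with the published facts + the partner data as the only
  extra binders.

What is NOT here: `stub_lowerSmallImage` (the Eisenstein half at small image — no engine in print; the
crux stays OPEN); the per-pair records (separate file); anything for pairs without a unit partner of
conductor `< 5·10⁵` (typed remainder of the seat's memo); anything booked.

References: [BDKim2009] Cor. 2.13 (p. 187), §2 p. 182, p. 186; [BDKim2013] Cor. 3.15 (p. 199);
[Kobayashi2003] Thm. 1.2, Thm. 4.1, Conjecture (p. 2); [SilvermanAEC2009] Thm. X.4.2;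
[GreenbergVatsal2000] p. 2 (1)–(2) and §1 (the ordinary prototype "the main conjecture is trivially
true"); [Miller2011LMS] Def. 1.1.
-/

set_option autoImplicit false
set_option linter.dupNamespace false

noncomputable section

open scoped Classical MatrixGroups ModularForm

open CongruenceSubgroup WeierstrassCurve Literature.NumberTheory.EllipticCurves
  Literature.NumberTheory.EllipticCurves.ModularForms
  Literature.NumberTheory.EllipticCurves.Rank1Residual
  Literature.NumberTheory.EllipticCurves.Rank1Residual.Typed
  Literature.NumberTheory.EllipticCurves.Kobayashi2003 ZpExtension
  Literature.NumberTheory.EllipticCurves.GreenbergVatsal2000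
  Literature.NumberTheory.EllipticCurves.BDKim2009
  Summit.BirchSwinnertonDyer.Rank1Residual.Supersingular
  Summit.BirchSwinnertonDyer.Rank1Residual.X1.MuLambda

namespace Summit.BirchSwinnertonDyer.BirchSwinnertonDyer.Theorems

/-! ### §1 The partner side: trivial `p`-Selmer group and `p ∤ ∏ c_ℓ` ⟹ `μ(X^ε) = 0` (B. D. Kim 2013) -/

section UnitCase

variable (V : WeierstrassCurve ℚ) [V.IsElliptic] [V.IsGloballyMinimal] (p : ℕ) [Fact p.Prime]

/-- **The algebraic unit case: `#Sel^(p)(V/ℚ) = 1` and `p ∤ ∏_ℓ c_ℓ(V)` ⟹ `μ(X^ε(V/ℚ_∞)) = 0` for every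
sign and every dual datum — B. D. Kim 2013 Cor. 3.15 alone.** Let `p` be an odd prime of good
reduction of `V` with `a_p(V) = 0` (ANY image), `#Sel^(p)(V/ℚ) = 1` (`hSel`, a descent certificate)
and `p ∤ ∏_ℓ c_ℓ(V)` (`htam`). Granted BY NAME Kobayashi 2003 Thm. 1.2 (`h12`: `X^ε` finitely
generated torsion) and B. D. Kim 2013 Cor. 3.15 (`hKim`: `ξ^ε(0) = u·p^{ord_p ∏c_ℓ}·#Sel_{p^∞}(V/ℚ)`):
`#Sel^(p) = 1` gives `#Sel_{p^∞}(V/ℚ) = 1` (fact-free, Silverman X.4.2: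
`natCard_selmerGroupPInfty_eq_one_of_natCard_selmerGroup_eq_one`), so a generator `ξ^ε` of `char X^ε`
has `ξ^ε(0) = u ∈ ℤ_p^×`, hence unit content, hence `μ(X^ε) = 0`
(`muInvariant_eq_zero_iff_hasUnitContent`). No main conjecture, no `p`-adic `L`-function, no
analytic rank. CONDITIONAL on the displayed binders; nothing asserted beyond them.
[cite: BDKim2013, Cor. 3.15 (p. 199)] [cite: Kobayashi2003, Thm. 1.2 (p. 2)]
[cite: SilvermanAEC2009, Thm X.4.2] [cite: GreenbergVatsal2000, p. 2 (2)] -/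
theorem signedMu_eq_zero_of_selmerTrivial (h12 : Kobayashi2003.thm12_signedSelmerDual_finite_torsion)
    (hKim : BDKim2013.cor315_signedCharValue_rankZero)
    (hp : p ≠ 2) (hgood : V.HasGoodReductionAtPrime p) (hap : V.frobeniusTrace p = 0)
    (hSel : Nat.card (V.selmerGroup (p : ℤ)) = 1) (htam : ¬ p ∣ V.tamagawaProduct)
    {κ : ZpExtension ℚ p} {γ : Field.absoluteGaloisGroup ℚ} (hκ : κ.IsCyclotomic)
    (hγ : κ.IsTopGenerator γ) (ε : ℤˣ) (D : SignedSelmerDualData V κ γ ε) : D.mu = 0 := by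
  haveI hfin : Module.Finite (IwasawaAlgebra p) D.X := h12.moduleFinite hp hgood hap hκ hγ D
  have hX : Module.IsTorsion (IwasawaAlgebra p) D.X := h12.isTorsion hp hgood hap hκ hγ D
  obtain ⟨ξ, hξ⟩ := (charIdeal_isPrincipal_holds p D.X).principal
  have hξ' : D.charIdeal = Ideal.span {ξ} := hξ
  -- `#Sel_{p^∞}(V/ℚ) = 1`, fact-free from `#Sel^(p)(V/ℚ) = 1`
  have hSel' : Nat.card (V.selmerGroupPInfty p) = 1 :=
    natCard_selmerGroupPInfty_eq_one_of_natCard_selmerGroup_eq_one V p hSel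
  have hSelfin : Finite (V.selmerGroupPInfty p) :=
    Nat.finite_of_card_ne_zero (by rw [hSel']; exact one_ne_zero)
  -- Kim 2013: `ξ(0) = u · p^{ord_p ∏c} · #Sel_{p^∞} = u`
  obtain ⟨u, hu⟩ := hKim V p hp hgood hap κ γ hκ hγ ε D hX ξ hξ' hSelfin
  rw [hSel', Nat.cast_one, mul_one, padicValNat.eq_zero_of_not_dvd htam, pow_zero, mul_one] at hu
  have hξu : PowerSeries.constantCoeff ξ = (u : ℤ_[p]) := PadicInt.ext hu
  have huc : HasUnitContent ξ :=
    ⟨0, by rw [PowerSeries.coeff_zero_eq_constantCoeff, hξu]; exact Units.isUnit u⟩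
  exact (muInvariant_eq_zero_iff_hasUnitContent D.X hX hξ').mpr huc

end UnitCase

/-! ### §2 `μ(X^ε(E)) = 0` from a UNIT partner: B. D. Kim 2013 + B. D. Kim 2009 -/

section Partner

variable (W A : WeierstrassCurve ℚ) [W.IsElliptic] [W.IsGloballyMinimal] [A.IsElliptic]
  [A.IsGloballyMinimal] (p : ℕ) [Fact p.Prime]

/-- **A unit partner supplies `μ(X^ε(E/ℚ_∞)) = 0`, every sign, every datum — PUBLISHED inputs only,
NO CM, NO `p`-adic `L`-function of the partner.** Let `p` be an odd prime of good reduction of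
`E = W` with `a_p = 0` (ANY image), and `A` a curve of good reduction at `p` with `a_p(A) = 0`, a
`Γ_ℚ`-equivariant `E[p] ≃ A[p]` (`hiso`), `#Sel^(p)(A/ℚ) = 1` (`hSelA`) and `p ∤ ∏_ℓ c_ℓ(A)` (`htamA`).
Granted BY NAME B. D. Kim 2009 Cor. 2.13 (`h09`; printed hypotheses = these: `p` odd, both curves good
at `p` with `a_p = 0`, `E[p] ≅ A[p]` as `G_ℚ`-modules — Asian J. Math. 13 pp. 182, 186), Kobayashi
Thm. 1.2 (`h12`) and B. D. Kim 2013 Cor. 3.15 (`hKim`): `μ(X^ε(E/ℚ_∞)) = 0`. Chain: §1 gives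
`μ(X^ε(A)) = 0`; Kim 2009 transfers it. CONDITIONAL on the displayed binders.
[cite: BDKim2009, Cor. 2.13 (p. 187); §2 p. 182, p. 186 (hypotheses)] [cite: BDKim2013, Cor. 3.15 (p. 199)]
[cite: Kobayashi2003, Thm. 1.2 (p. 2)] -/
theorem mu_eq_zero_of_unitPartner (h09 : cor213_signedMu_eq_zero_iff_of_torsionIso)
    (h12 : Kobayashi2003.thm12_signedSelmerDual_finite_torsion)
    (hKim : BDKim2013.cor315_signedCharValue_rankZero)
    (hp : p ≠ 2) (hgood : W.HasGoodReductionAtPrime p) (hap : W.frobeniusTrace p = 0)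
    (hgoodA : A.HasGoodReductionAtPrime p) (hapA : A.frobeniusTrace p = 0)
    (hiso : ∃ e : geomTorsion W (p : ℤ) ≃+ geomTorsion A (p : ℤ),
      ∀ (σ : Field.absoluteGaloisGroup ℚ) (P : geomTorsion W (p : ℤ)), e (σ • P) = σ • e P)
    (hSelA : Nat.card (A.selmerGroup (p : ℤ)) = 1) (htamA : ¬ p ∣ A.tamagawaProduct)
    {κ : ZpExtension ℚ p} {γ : Field.absoluteGaloisGroup ℚ} (hκ : κ.IsCyclotomic)
    (hγ : κ.IsTopGenerator γ) (ε : ℤˣ) (D : SignedSelmerDualData W κ γ ε) : D.mu = 0 := by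
  obtain ⟨D'⟩ := nonempty_signedSelmerDualData A κ ε hγ
  haveI : Module.Finite (IwasawaAlgebra p) D.X := h12.moduleFinite hp hgood hap hκ hγ D
  haveI : Module.Finite (IwasawaAlgebra p) D'.X := h12.moduleFinite hp hgoodA hapA hκ hγ D'
  have hX : Module.IsTorsion (IwasawaAlgebra p) D.X := h12.isTorsion hp hgood hap hκ hγ D
  have hX' : Module.IsTorsion (IwasawaAlgebra p) D'.X := h12.isTorsion hp hgoodA hapA hκ hγ D'
  have hμ' : D'.mu = 0 :=
    signedMu_eq_zero_of_selmerTrivial A p h12 hKim hp hgoodA hapA hSelA htamA hκ hγ ε D'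
  exact (h09 W A p hp hgood hap hgoodA hapA hiso κ γ hκ hγ ε D D' hX hX').mpr hμ'

end Partner

/-! ### §3 The class theorems of the line with a UNIT partner (no CM, no preprint) -/

section ClassTheorems

variable (W A : WeierstrassCurve ℚ) [W.IsElliptic] [W.IsGloballyMinimal] [A.IsElliptic]
  [A.IsGloballyMinimal] (p : ℕ) [Fact p.Prime]

/-- **The unit-partner transfer in rank `0`, PUBLISHED inputs + `BSD(E,p)` — NO CM, NO preprint.**
`E = W` with `p` odd good, `a_p = 0` (ANY image), `ord_{s=1} L(E,s) = 0` and `BSDp W p` (settled per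
pair in the tree, e.g. by the exact-descent theorems `bsdp3_nn<label>` / `bsdp_s<label>`); a unit
partner `A` (good at `p`, `a_p(A) = 0`, `E[p] ≃ A[p]` `Γ_ℚ`-equivariantly, `#Sel^(p)(A/ℚ) = 1`,
`p ∤ ∏_ℓ c_ℓ(A)`). Granted BY NAME B. D. Kim 2009 Cor. 2.13 (`h09`), Kobayashi 2003 Thm. 1.2 (`h12`)
and Thm. 4.1 (`h41`, rational clause), B. D. Kim 2013 Cor. 3.15 (`hKim`), the period-unit facts
(`h5`, `h3`), GZK (`hGZK`) and modularity (`hmod'`): `KobayashiMainConjecture W p ε` for EVERY sign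
`ε` (§2 ⟹ `μ(X^ε(E)) = 0` ⟹ part 1 §2). Compare
`kobayashiMainConjecture_of_cmPartner_of_bsdp_of_analyticRank_eq_zero` (CM partner: + Pollack–Rubin,
Pollack, the partner's newform and a `μ`-certificate). CONDITIONAL on the displayed binders; per
pair; closes nothing. [cite: BDKim2009, Cor. 2.13 (p. 187)] [cite: BDKim2013, Cor. 3.15 (p. 199)]
[cite: Kobayashi2003, Thm. 1.2, Thm. 4.1 and Conjecture (p. 2)] [cite: Miller2011LMS, Def. 1.1] -/
theorem kobayashiMainConjecture_of_unitPartner_of_bsdp_of_analyticRank_eq_zero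
    (h09 : cor213_signedMu_eq_zero_iff_of_torsionIso)
    (h12 : Kobayashi2003.thm12_signedSelmerDual_finite_torsion)
    (h41 : Kobayashi2003.thm41_signedCharIdeal_divisibility)
    (hKim : BDKim2013.cor315_signedCharValue_rankZero)
    (h5 : realPeriodRat_eq_unit_mul_plusPeriod) (h3 : realPeriodRat_eq_unit_mul_plusPeriod_three)
    (hGZK : rank_eq_analyticRank_of_analyticRank_le_one) (hmod' : hasEntireLFunction_rat)
    (hp : p ≠ 2) (hgood : W.HasGoodReductionAtPrime p) (hap : W.frobeniusTrace p = 0)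
    (hgoodA : A.HasGoodReductionAtPrime p) (hapA : A.frobeniusTrace p = 0)
    (hiso : ∃ e : geomTorsion W (p : ℤ) ≃+ geomTorsion A (p : ℤ),
      ∀ (σ : Field.absoluteGaloisGroup ℚ) (P : geomTorsion W (p : ℤ)), e (σ • P) = σ • e P)
    (hSelA : Nat.card (A.selmerGroup (p : ℤ)) = 1) (htamA : ¬ p ∣ A.tamagawaProduct)
    (h0 : W.analyticRank = 0) (hB : BSDp W p) (ε : ℤˣ) : KobayashiMainConjecture W p ε :=
  kobayashiMainConjecture_of_mu_eq_zero_of_bsdp_of_analyticRank_eq_zero W p h12 h41 hKim h5 h3 hGZK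
    hmod' hp hgood hap
    (fun _κ _γ hκ hγ _ D ↦ mu_eq_zero_of_unitPartner W A p h09 h12 hKim hp hgood hap hgoodA hapA hiso
      hSelA htamA hκ hγ ε D)
    h0 hB

/-- **On the unit-partnered rank-`0` locus Kobayashi's main conjecture (either sign) is EQUIVALENT to
`BSD(E,p)`** — PUBLISHED inputs + the partner data only. Forward: the tree's image-free
`bsdp_of_kobayashiMainConjecture_of_analyticRank_eq_zero` (Kim + Pollack + GZK + modularity; `E[p]`
irreducible as `a_p = 0`); backward: `kobayashiMainConjecture_of_unitPartner_of_bsdp_…`. CONDITIONAL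
on the displayed binders; closes nothing. [cite: BDKim2009, Cor. 2.13 (p. 187)]
[cite: Kobayashi2003, Thm. 4.1 (p. 8) and Conjecture (p. 2)] [cite: BDKim2013, Cor. 3.15 (p. 199)]
[cite: Miller2011LMS, Def. 1.1] -/
theorem kobayashiMainConjecture_iff_bsdp_of_unitPartner_of_analyticRank_eq_zero
    (h09 : cor213_signedMu_eq_zero_iff_of_torsionIso)
    (h12 : Kobayashi2003.thm12_signedSelmerDual_finite_torsion)
    (h41 : Kobayashi2003.thm41_signedCharIdeal_divisibility)
    (hKim : BDKim2013.cor315_signedCharValue_rankZero)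
    (h5 : realPeriodRat_eq_unit_mul_plusPeriod) (h3 : realPeriodRat_eq_unit_mul_plusPeriod_three)
    (hPollack : ∀ {V : WeierstrassCurve ℚ} [V.IsElliptic] [V.IsGloballyMinimal] {N : ℕ} [NeZero N]
      {g : CuspForm (Gamma0 N) 2} {q : ℕ} [Fact q.Prime],
      pollack_exists_plusMinusPAdicLFunction (W := V) (f := g) (p := q))
    (hmod : nonempty_modularParametrizationData) (hmod' : hasEntireLFunction_rat)
    (hGZK : rank_eq_analyticRank_of_analyticRank_le_one)
    (hp : p ≠ 2) (hgood : W.HasGoodReductionAtPrime p) (hap : W.frobeniusTrace p = 0)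
    (hgoodA : A.HasGoodReductionAtPrime p) (hapA : A.frobeniusTrace p = 0)
    (hiso : ∃ e : geomTorsion W (p : ℤ) ≃+ geomTorsion A (p : ℤ),
      ∀ (σ : Field.absoluteGaloisGroup ℚ) (P : geomTorsion W (p : ℤ)), e (σ • P) = σ • e P)
    (hSelA : Nat.card (A.selmerGroup (p : ℤ)) = 1) (htamA : ¬ p ∣ A.tamagawaProduct)
    (h0 : W.analyticRank = 0) (ε : ℤˣ) : KobayashiMainConjecture W p ε ↔ BSDp W p := by
  have hirr : W.HasIrreducibleModPGaloisRep p :=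
    hasIrreducibleModPGaloisRep_of_dvd_frobeniusTrace W p hp
      (W.not_dvd_minimalDiscriminantInt_of_hasGoodReductionAtPrime' p hgood) (by rw [hap]; exact dvd_zero _)
  refine ⟨fun hMC ↦ ?_, fun hB ↦ ?_⟩
  · exact bsdp_of_kobayashiMainConjecture_of_analyticRank_eq_zero W p h12 hKim hPollack hmod hmod' hGZK
      hp hgood hap hirr h0 hMC
  · exact kobayashiMainConjecture_of_unitPartner_of_bsdp_of_analyticRank_eq_zero W A p h09 h12 h41 hKim
      h5 h3 hGZK hmod' hp hgood hap hgoodA hapA hiso hSelA htamA h0 hB ε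

omit [A.IsElliptic] [A.IsGloballyMinimal] in
/-- **The degenerate partner `A = E` (the UNIT ZONE, descent form): `#Sel^(p)(E/ℚ) = 1`,
`p ∤ ∏_ℓ c_ℓ(E)`, `r_an = 0`, `BSD(E,p)` ⟹ Kobayashi's main conjecture for BOTH signs** — with NO
congruence and NO B. D. Kim 2009: §1 applied to `E` itself feeds part 1 §2. Same locus as
`smallImage_kobayashiMainConjecture_of_units_of_bsdp_of_analyticRank_eq_zero`
(`…SmallImageSaturationRankZero.lean`, seat gen 0: `p ∤ ∏c·#Ш_an` + `BSD(E,p)`), read on the descent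
certificate instead of `#Ш_an`. CONDITIONAL on the displayed binders; per pair; closes nothing.
[cite: BDKim2013, Cor. 3.15 (p. 199)] [cite: Kobayashi2003, Thm. 1.2, Thm. 4.1 and Conjecture (p. 2)]
[cite: Miller2011LMS, Def. 1.1] -/
theorem kobayashiMainConjecture_of_selmerTrivial_of_bsdp_of_analyticRank_eq_zero
    (h12 : Kobayashi2003.thm12_signedSelmerDual_finite_torsion)
    (h41 : Kobayashi2003.thm41_signedCharIdeal_divisibility)
    (hKim : BDKim2013.cor315_signedCharValue_rankZero)
    (h5 : realPeriodRat_eq_unit_mul_plusPeriod) (h3 : realPeriodRat_eq_unit_mul_plusPeriod_three)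
    (hGZK : rank_eq_analyticRank_of_analyticRank_le_one) (hmod' : hasEntireLFunction_rat)
    (hp : p ≠ 2) (hgood : W.HasGoodReductionAtPrime p) (hap : W.frobeniusTrace p = 0)
    (hSel : Nat.card (W.selmerGroup (p : ℤ)) = 1) (htam : ¬ p ∣ W.tamagawaProduct)
    (h0 : W.analyticRank = 0) (hB : BSDp W p) (ε : ℤˣ) : KobayashiMainConjecture W p ε :=
  kobayashiMainConjecture_of_mu_eq_zero_of_bsdp_of_analyticRank_eq_zero W p h12 h41 hKim h5 h3 hGZK
    hmod' hp hgood hap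
    (fun _κ _γ hκ hγ _ D ↦ signedMu_eq_zero_of_selmerTrivial W p h12 hKim hp hgood hap hSel htam hκ hγ ε D)
    h0 hB

/-- **Saturation for unit-partnered pairs, ANY rank — PUBLISHED inputs + the partner data.** `E = W`
with `p` odd good, `a_p = 0`; a unit partner `A` as in `mu_eq_zero_of_unitPartner`. Then for EVERY
sign the Eisenstein half `KobayashiLowerDivisibility W p ε` already implies
`KobayashiMainConjecture W p ε` (§2 ⟹ `μ(X^ε(E)) = 0` ⟹ part 1 §3). No `BSD(E,p)`, no rank
hypothesis. CONDITIONAL on the displayed binders; closes nothing.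
[cite: BDKim2009, Cor. 2.13 (p. 187)] [cite: BDKim2013, Cor. 3.15 (p. 199)]
[cite: Kobayashi2003, Thm. 1.2, Thm. 4.1 and Conjecture (p. 2)] -/
theorem kobayashiMainConjecture_of_unitPartner_of_lowerDivisibility
    (h09 : cor213_signedMu_eq_zero_iff_of_torsionIso)
    (h12 : Kobayashi2003.thm12_signedSelmerDual_finite_torsion)
    (h41 : Kobayashi2003.thm41_signedCharIdeal_divisibility)
    (hKim : BDKim2013.cor315_signedCharValue_rankZero)
    (h5 : realPeriodRat_eq_unit_mul_plusPeriod) (h3 : realPeriodRat_eq_unit_mul_plusPeriod_three)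
    (hp : p ≠ 2) (hgood : W.HasGoodReductionAtPrime p) (hap : W.frobeniusTrace p = 0)
    (hgoodA : A.HasGoodReductionAtPrime p) (hapA : A.frobeniusTrace p = 0)
    (hiso : ∃ e : geomTorsion W (p : ℤ) ≃+ geomTorsion A (p : ℤ),
      ∀ (σ : Field.absoluteGaloisGroup ℚ) (P : geomTorsion W (p : ℤ)), e (σ • P) = σ • e P)
    (hSelA : Nat.card (A.selmerGroup (p : ℤ)) = 1) (htamA : ¬ p ∣ A.tamagawaProduct)
    {ε : ℤˣ} (hlow : KobayashiLowerDivisibility W p ε) : KobayashiMainConjecture W p ε :=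
  kobayashiMainConjecture_of_mu_eq_zero_of_lowerDivisibility W p h12 h41 h5 h3 hp hgood hap
    (fun _κ _γ hκ hγ _ D ↦ mu_eq_zero_of_unitPartner W A p h09 h12 hKim hp hgood hap hgoodA hapA hiso
      hSelA htamA hκ hγ ε D)
    hlow

end ClassTheorems

/-- **The registered stub `stub_saturationSmallImage` of crux `KobayashiMainConjectureSmallImage`
(BC3 skeleton, header VERBATIM) for UNIT-PARTNERED pairs — PUBLISHED facts + the partner data as the
only extra leading binders; NO CM, NO preprint.** Extra binders: B. D. Kim 2009 Cor. 2.13 (`h09`),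
Kobayashi Thm. 1.2 / Thm. 4.1 (`h12`, `h41`), B. D. Kim 2013 Cor. 3.15 (`hKim`), the period-unit
facts (`h5`, `h3`), and — per curve — `hpartner`: a curve `A` good at `p` with `a_p(A) = 0`, a
`Γ_ℚ`-equivariant `W[p] ≃ A[p]`, `#Sel^(p)(A/ℚ) = 1` and `p ∤ ∏_ℓ c_ℓ(A)`. Then for EVERY sign
`lower ⟹ equality` (`kobayashiMainConjecture_of_unitPartner_of_lowerDivisibility`). The stub's own
binders `ClassX7`, `¬CM`, `¬Surj` are carried unused (the argument is image-free). Compare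
`stub_saturationSmallImage_of_cmPartner` (CM partner, + Pollack–Rubin / Pollack / modular
parametrisation / a `μ`-certificate). CONDITIONAL; closes nothing.
[cite: BDKim2009, Cor. 2.13 (p. 187)] [cite: BDKim2013, Cor. 3.15 (p. 199)]
[cite: Kobayashi2003, Thm. 4.1 (p. 8) and Conjecture (p. 2)] -/
theorem stub_saturationSmallImage_of_unitPartner
    (h09 : cor213_signedMu_eq_zero_iff_of_torsionIso)
    (h12 : Kobayashi2003.thm12_signedSelmerDual_finite_torsion)
    (h41 : Kobayashi2003.thm41_signedCharIdeal_divisibility)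
    (hKim : BDKim2013.cor315_signedCharValue_rankZero)
    (h5 : realPeriodRat_eq_unit_mul_plusPeriod) (h3 : realPeriodRat_eq_unit_mul_plusPeriod_three) :
    ∀ (W : WeierstrassCurve ℚ) [W.IsElliptic] [W.IsGloballyMinimal] (p : ℕ) [Fact p.Prime],
      p ≠ 2 → Literature.NumberTheory.EllipticCurves.Rank1Residual.ClassX7 W p → ¬ W.HasCM →
      W.frobeniusTrace p = 0 → ¬ Literature.NumberTheory.EllipticCurves.Rank1Residual.Surj W p →
      (∃ (A : WeierstrassCurve ℚ) (_ : A.IsElliptic) (_ : A.IsGloballyMinimal),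
        A.HasGoodReductionAtPrime p ∧ A.frobeniusTrace p = 0 ∧
        (∃ e : geomTorsion W (p : ℤ) ≃+ geomTorsion A (p : ℤ),
          ∀ (σ : Field.absoluteGaloisGroup ℚ) (P : geomTorsion W (p : ℤ)), e (σ • P) = σ • e P) ∧
        Nat.card (A.selmerGroup (p : ℤ)) = 1 ∧ ¬ p ∣ A.tamagawaProduct) →
      ∀ ε : ℤˣ, Summit.BirchSwinnertonDyer.Rank1Residual.Supersingular.KobayashiLowerDivisibility W p ε →
        Summit.BirchSwinnertonDyer.Rank1Residual.Supersingular.KobayashiMainConjecture W p ε := by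
  intro W _ _ p _ hp hX _hcm hap _hs hpartner ε hlow
  obtain ⟨A, _, _, hgoodA, hapA, hiso, hSelA, htamA⟩ := hpartner
  exact kobayashiMainConjecture_of_unitPartner_of_lowerDivisibility W A p h09 h12 h41 hKim h5 h3 hp
    hX.1.1 hap hgoodA hapA hiso hSelA htamA hlow

end Summit.BirchSwinnertonDyer.BirchSwinnertonDyer.Theorems

end
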